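import Mathlib
import HarnessLib

/-!
# Item `LrcModEntire` (stmt-NavierStokesRegularity-20428), skeleton twist_split v6, CLASS road to `stub_twistingTHGerm` —
# the plane-oscillation law (OSC) in SIMILARITY VARIABLES: no self-similar oscillation profile, for ANY compression constant

Cell ns-regularity-ideate, LEAD ns-poloidal-K2-p3 g13 (`--supports stmt-NavierStokesRegularity-20428`; sequel of ns-k2-port-2's
`…TwistingTHPlaneOscillationEnvelope` (p681808, (OSC) in classical-touching form) and `…TwistingTHPlaneOscillationEndgame`
(the Dini–Grönwall endgame, conclusive for a compression constant `K = sup (−t)|S_z|/2 < 1/2` only)).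

THE POINT.  In similarity variables `ξ = z/√(−t)`, `τ = −log(−t)`, `Ô = √(−t)·O`, `Ŝ = √(−t)·S` the law
(OSC) `∂ₜO + ½∂_z(S·O) − ∂_zzO ≤ 0` (`O ≥ 0` = plane oscillation of the Clebsch weight `W = (1−μ)v₂`, `S` = plane max + min of `v₂`,
`|S| ≤ 2N/√(−t)` by the hot-spot normalisation) becomes the Fokker–Planck inequality
`∂_τÔ + ½∂_ξ((ξ + Ŝ)·Ô) ≤ ∂_ξξÔ` with `|Ŝ| ≤ A := 2N`: the Type-I scaling contributes the EXPLOSIVE drift `ξ/2`, which dominates the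
bounded Navier–Stokes drift `Ŝ/2` outside `|ξ| ≤ A` WHATEVER the Lipschitz constant `K` of `Ŝ` is.  This file proves the
τ-independent (= backward self-similar) case of the resulting Liouville statement, as pure one-variable real analysis:

* `hasDerivAt_selfSimilar_time` — for the self-similar ansatz `O(t,z) = Ô(z/√(−t))/√(−t)` the time derivative at `t = −1` is
  `½Ô(z) + ½zÔ′(z)`; so (OSC) at the slice `t = −1` (where `O(−1,·) = Ô`, `S(−1,·) = Ŝ`) is literally the ODE inequality below.
* `profile_eq_zero_of_similarityODE` — **if `Ô ∈ C²`, `0 ≤ Ô ≤ B`, `Ŝ` differentiable with `|Ŝ| ≤ A`, and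
  `½Ô + ½ξÔ′ + ½(ŜÔ)′ − Ô″ ≤ 0` on `ℝ`, then `Ô ≡ 0`** — no hypothesis on `Ŝ′` (no `K`).  Proof: `g := Ô′ − ½(ξ+Ŝ)Ô` is
  non-decreasing; if `g(ξ₁) > 0` then `Ô′ ≥ g(ξ₁)` on `[max ξ₁ A, ∞)` and `Ô` is unbounded; otherwise `Ô′ ≤ ½(ξ+A)Ô` everywhere, so
  `Ô·e^{−(ξ+A)²/4}` is non-increasing and tends to `0` at `−∞`, hence vanishes.
* `selfSimilar_osc_eq_zero` — the two combined: a self-similar pair `(O,S)` obeying (OSC) on the slice `t = −1` with `Ô` bounded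
  non-negative and `Ŝ` bounded has `Ô ≡ 0` (every plane of the slice is flat for the weight `W`).

So for self-similar data the «K < 1/2» threshold of `…Endgame.eq_zero_of_dini_of_typeI` disappears; the LEAD's memo OSC-LIOUVILLE-g13
(crux dir) argues the same for general τ-dependence (escape of the dual diffusion from `|ξ| ≤ A+2`), which relocates the wall of the
class road from «K < 1/2» to «`√(−t)·osc_plane W` bounded toward the past» (a scale-invariant bound on the slope `1 − μ`).

WHAT THIS IS NOT: not a claim about Navier–Stokes regularity and not the stub `stub_twistingTHGerm` — one-variable analysis of the
located law (OSC) (bears_on LADDER-NS N0, item 20428 / crux 19708; 20428 and 19708 stay OPEN).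
-/

noncomputable section

-- the summit and its single sub-problem share the name (CONVENTIONS §1), as in every Theorems file
set_option linter.dupNamespace false

namespace Summit.NavierStokesRegularity.NavierStokesRegularity.Theorems.PoloidalWindowDoorLrcModEntireTwistingTHPlaneOscillationSimilarity

open Set Filter Topology

/-! ### Calculus helpers -/

/-- The Gaussian-type weight `E(ξ) = exp(−(ξ+A)²/4)` and its derivative `E′ = −½(ξ+A)·E`. -/
theorem hasDerivAt_gaussWeight (A ξ : ℝ) :
    HasDerivAt (fun x : ℝ => Real.exp (-((x + A) ^ 2 / 4))) (-((ξ + A) / 2) * Real.exp (-((ξ + A) ^ 2 / 4))) ξ := by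
  have h1 : HasDerivAt (fun x : ℝ => -((x + A) ^ 2 / 4)) (-((ξ + A) / 2)) ξ := by
    have h : HasDerivAt (fun x : ℝ => -((x + A) ^ 2 / 4)) (-(((2 : ℕ) : ℝ) * (ξ + A) ^ (2 - 1) * 1 / 4)) ξ :=
      ((((hasDerivAt_id ξ).add_const A).fun_pow 2).div_const 4).fun_neg
    refine h.congr_deriv ?_
    norm_num
    ring
  exact h1.exp.congr_deriv (by ring)

/-- `(ξ + A)²/4 → +∞` as `ξ → −∞`. -/
theorem tendsto_sq_shift_atBot (A : ℝ) : Tendsto (fun x : ℝ => (x + A) ^ 2 / 4) atBot atTop := by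
  refine tendsto_atBot_atTop.2 fun b => ⟨-A - 4 * |b| - 1, fun x hx => ?_⟩
  have h1 : 4 * |b| + 1 ≤ -(x + A) := by linarith
  have h2 : 0 ≤ -(x + A) := by linarith [abs_nonneg b]
  have h3 : (4 * |b| + 1) * 1 ≤ (-(x + A)) * (-(x + A)) :=
    mul_le_mul h1 (by linarith [abs_nonneg b]) zero_le_one h2
  have h4 : (x + A) ^ 2 = (-(x + A)) * (-(x + A)) := by ring
  rw [h4]
  have hb : b ≤ |b| := le_abs_self b
  linarith

/-- `B·exp(−(ξ+A)²/4) → 0` as `ξ → −∞`. -/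
theorem tendsto_gaussWeight_atBot (A B : ℝ) :
    Tendsto (fun x : ℝ => B * Real.exp (-((x + A) ^ 2 / 4))) atBot (𝓝 0) := by
  have h := (Real.tendsto_exp_neg_atTop_nhds_zero.comp (tendsto_sq_shift_atBot A)).const_mul B
  simpa using h

/-! ### The self-similar ansatz: time derivative at the slice `t = −1` -/

/-- **Time derivative of the self-similar ansatz.**  For `O(t,z) = Ô(z/√(−t))/√(−t)` (written with inverses) and `Ô` differentiable at `z`,
`∂ₜO(−1,z) = ½Ô(z) + ½ z Ô′(z)`.  Hence, with `S(t,z) = Ŝ(z/√(−t))/√(−t)`, the law (OSC) at the slice `t = −1` reads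
`½Ô + ½ξÔ′ + ½(ŜÔ)′ − Ô″ ≤ 0`, the hypothesis of `profile_eq_zero_of_similarityODE`. -/
theorem hasDerivAt_selfSimilar_time {Ô : ℝ → ℝ} {z : ℝ} (hÔ : DifferentiableAt ℝ Ô z) :
    HasDerivAt (fun t : ℝ => Ô (z * (Real.sqrt (-t))⁻¹) * (Real.sqrt (-t))⁻¹)
      ((1 / 2) * Ô z + (1 / 2) * z * deriv Ô z) (-1) := by
  -- `r(t) = (√(−t))⁻¹`: `r(−1) = 1`, `r′(−1) = 1/2`
  have hs1 : Real.sqrt (-(-1 : ℝ)) = 1 := by simp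
  have hs : HasDerivAt (fun t : ℝ => Real.sqrt (-t)) (-(1 / 2)) (-1) := by
    have h1 : HasDerivAt (fun t : ℝ => -t) (-1) (-1) := (hasDerivAt_id (-1 : ℝ)).fun_neg
    have h2 := (Real.hasDerivAt_sqrt (show -(-1 : ℝ) ≠ 0 by norm_num)).comp (-1) h1
    refine h2.congr_deriv ?_
    rw [hs1]; norm_num
  have hr : HasDerivAt (fun t : ℝ => (Real.sqrt (-t))⁻¹) (1 / 2) (-1) := by
    refine (hs.fun_inv (by rw [hs1]; norm_num)).congr_deriv ?_
    rw [hs1]; norm_num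
  -- inner map `t ↦ z·r(t)`
  have hin : HasDerivAt (fun t : ℝ => z * (Real.sqrt (-t))⁻¹) (z * (1 / 2)) (-1) := hr.const_mul z
  have hin1 : z * (Real.sqrt (-(-1 : ℝ)))⁻¹ = z := by rw [hs1]; simp
  have hÔ' : HasDerivAt Ô (deriv Ô z) (z * (Real.sqrt (-(-1 : ℝ)))⁻¹) := by
    rw [hin1]; exact hÔ.hasDerivAt
  have hcomp : HasDerivAt (fun t : ℝ => Ô (z * (Real.sqrt (-t))⁻¹)) (deriv Ô z * (z * (1 / 2))) (-1) :=
    hÔ'.comp (-1) hin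
  refine (hcomp.fun_mul hr).congr_deriv ?_
  rw [hin1, hs1]; simp; ring

/-! ### The Liouville lemma for the similarity ODE (no `K`) -/

/-- **NO SELF-SIMILAR OSCILLATION PROFILE, FOR ANY COMPRESSION.**  Let `Ô ∈ C²(ℝ)` with `0 ≤ Ô ≤ B`, let `Ŝ` be differentiable with
`|Ŝ| ≤ A`, and suppose the similarity form of (OSC) holds on `ℝ`:  `½Ô(ξ) + ½ξÔ′(ξ) + ½(Ŝ·Ô)′(ξ) − Ô″(ξ) ≤ 0`.  Then `Ô ≡ 0`.
No bound on `Ŝ′` is used: the explosive similarity drift `ξ/2` beats the bounded drift `Ŝ/2` outside `|ξ| ≤ A`. -/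
theorem profile_eq_zero_of_similarityODE {Ô Ŝ : ℝ → ℝ} {A B : ℝ} (hÔ : ContDiff ℝ 2 Ô) (hŜ : Differentiable ℝ Ŝ)
    (hA : ∀ ξ, |Ŝ ξ| ≤ A) (h0 : ∀ ξ, 0 ≤ Ô ξ) (hB : ∀ ξ, Ô ξ ≤ B)
    (hode : ∀ ξ, (1 / 2) * Ô ξ + (1 / 2) * ξ * deriv Ô ξ + (1 / 2) * deriv (fun x => Ŝ x * Ô x) ξ
      - deriv (deriv Ô) ξ ≤ 0) :
    ∀ ξ, Ô ξ = 0 := by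
  have hÔd : Differentiable ℝ Ô := hÔ.differentiable (by norm_num)
  have hÔ'd : Differentiable ℝ (deriv Ô) :=   -- (`…Envelope.differentiable_deriv_of_contDiff_two`, inlined to keep the imports light)
    ((contDiff_succ_iff_deriv.1 (show ContDiff ℝ ((1 : WithTop ℕ∞) + 1) Ô from hÔ)).2.2).differentiable (by norm_num)
  -- `g := Ô′ − ½(ξ+Ŝ)Ô` is non-decreasing
  set g : ℝ → ℝ := fun ξ => deriv Ô ξ - (1 / 2) * (ξ + Ŝ ξ) * Ô ξ with hg
  have hlin : ∀ ξ, HasDerivAt (fun x : ℝ => x + Ŝ x) (1 + deriv Ŝ ξ) ξ := fun ξ =>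
    (hasDerivAt_id ξ).add (hŜ ξ).hasDerivAt
  have hgd : ∀ ξ, HasDerivAt g (deriv (deriv Ô) ξ
      - ((1 / 2) * (1 + deriv Ŝ ξ) * Ô ξ + (1 / 2) * (ξ + Ŝ ξ) * deriv Ô ξ)) ξ := by
    intro ξ
    have h1 : HasDerivAt (deriv Ô) (deriv (deriv Ô) ξ) ξ := (hÔ'd ξ).hasDerivAt
    have h2 : HasDerivAt (fun x : ℝ => (1 / 2) * (x + Ŝ x) * Ô x)
        ((1 / 2) * (1 + deriv Ŝ ξ) * Ô ξ + (1 / 2) * (ξ + Ŝ ξ) * deriv Ô ξ) ξ := by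
      have hc : HasDerivAt (fun x : ℝ => (1 / 2) * (x + Ŝ x)) ((1 / 2) * (1 + deriv Ŝ ξ)) ξ :=
        (hlin ξ).const_mul (1 / 2)
      exact hc.fun_mul (hÔd ξ).hasDerivAt
    exact h1.sub h2
  have hprod : ∀ ξ, deriv (fun x => Ŝ x * Ô x) ξ = deriv Ŝ ξ * Ô ξ + Ŝ ξ * deriv Ô ξ := fun ξ =>
    deriv_fun_mul (hŜ ξ) (hÔd ξ)
  have hg' : ∀ ξ, 0 ≤ deriv g ξ := by
    intro ξ
    rw [(hgd ξ).deriv]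
    have h := hode ξ
    rw [hprod ξ] at h
    nlinarith [h]
  have hgdiff : Differentiable ℝ g := fun ξ => (hgd ξ).differentiableAt
  have hgmono : Monotone g := monotone_of_deriv_nonneg hgdiff hg'
  have hA' : ∀ ξ, -A ≤ Ŝ ξ ∧ Ŝ ξ ≤ A := fun ξ => abs_le.1 (hA ξ)
  by_cases hcase : ∃ ξ₁, 0 < g ξ₁
  · -- Case A: `g(ξ₁) = c > 0` ⇒ `Ô′ ≥ c` on `[ξ₀, ∞)`, `ξ₀ = max ξ₁ A` ⇒ `Ô` unbounded
    exfalso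
    obtain ⟨ξ₁, hξ₁⟩ := hcase
    set c := g ξ₁ with hc
    set ξ₀ := max ξ₁ A with hξ₀
    have hderiv : ∀ ξ, ξ₀ ≤ ξ → c ≤ deriv Ô ξ := by
      intro ξ hξ
      have h1 : c ≤ g ξ := hgmono ((le_max_left _ _).trans hξ)
      have h2 : 0 ≤ (1 / 2) * (ξ + Ŝ ξ) * Ô ξ := by
        have : 0 ≤ ξ + Ŝ ξ := by linarith [(hA' ξ).1, (le_max_right ξ₁ A).trans hξ]
        have := h0 ξ
        positivity
      have h3 : g ξ = deriv Ô ξ - (1 / 2) * (ξ + Ŝ ξ) * Ô ξ := rfl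
      linarith
    -- `k(ξ) = Ô ξ − c ξ` is non-decreasing on `[ξ₀, ∞)`
    have hk : MonotoneOn (fun ξ => Ô ξ - c * ξ) (Ici ξ₀) := by
      refine monotoneOn_of_deriv_nonneg (convex_Ici ξ₀) ?_ ?_ ?_
      · exact ((hÔd.continuous).sub (continuous_const.mul continuous_id)).continuousOn
      · exact ((hÔd.sub (differentiable_const _ |>.mul differentiable_id))).differentiableOn
      · intro ξ hξ
        rw [interior_Ici] at hξ
        have hd : HasDerivAt (fun x => Ô x - c * x) (deriv Ô ξ - c * 1) ξ :=
          (hÔd ξ).hasDerivAt.sub ((hasDerivAt_id ξ).const_mul c)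
        rw [hd.deriv]
        linarith [hderiv ξ (le_of_lt hξ)]
    set L := (B + 1) / c with hL
    have hB1 : 0 < B + 1 := by linarith [h0 ξ₀, hB ξ₀]
    have hLpos : 0 ≤ L := by rw [hL]; exact div_nonneg hB1.le hξ₁.le
    have hmono := hk (self_mem_Ici (a := ξ₀)) (show ξ₀ + L ∈ Ici ξ₀ by simp [hLpos]) (by linarith)
    have h1 : c * L = B + 1 := by rw [hL]; field_simp
    have h2 : Ô (ξ₀ + L) ≥ Ô ξ₀ + c * L := by
      have : Ô ξ₀ - c * ξ₀ ≤ Ô (ξ₀ + L) - c * (ξ₀ + L) := hmono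
      linarith
    linarith [h0 ξ₀, hB (ξ₀ + L)]
  · -- Case B: `g ≤ 0` ⇒ `Ô′ ≤ ½(ξ+A)Ô` ⇒ `h = Ô·e^{−(ξ+A)²/4}` non-increasing, `→ 0` at `−∞`, hence `0`
    push Not at hcase
    have hle : ∀ ξ, deriv Ô ξ ≤ (1 / 2) * (ξ + A) * Ô ξ := by
      intro ξ
      have h1 : g ξ ≤ 0 := hcase ξ
      have h2 : g ξ = deriv Ô ξ - (1 / 2) * (ξ + Ŝ ξ) * Ô ξ := rfl
      have h3 : (1 / 2) * (ξ + Ŝ ξ) * Ô ξ ≤ (1 / 2) * (ξ + A) * Ô ξ := by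
        have := (hA' ξ).2
        have := h0 ξ
        nlinarith
      linarith
    set h : ℝ → ℝ := fun ξ => Ô ξ * Real.exp (-((ξ + A) ^ 2 / 4)) with hh
    have hhd : ∀ ξ, HasDerivAt h ((deriv Ô ξ - (1 / 2) * (ξ + A) * Ô ξ) * Real.exp (-((ξ + A) ^ 2 / 4))) ξ := by
      intro ξ
      exact ((hÔd ξ).hasDerivAt.fun_mul (hasDerivAt_gaussWeight A ξ)).congr_deriv (by ring)
    have hanti : Antitone h := by
      refine antitone_of_deriv_nonpos (fun ξ => (hhd ξ).differentiableAt) fun ξ => ?_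
      rw [(hhd ξ).deriv]
      have := hle ξ
      have := Real.exp_pos (-((ξ + A) ^ 2 / 4))
      nlinarith
    intro ξ
    have hup : ∀ᶠ x in atBot, h ξ ≤ B * Real.exp (-((x + A) ^ 2 / 4)) := by
      refine eventually_atBot.2 ⟨ξ, fun x hx => ?_⟩
      have h1 : h ξ ≤ h x := hanti hx
      have h2 : h x ≤ B * Real.exp (-((x + A) ^ 2 / 4)) :=
        mul_le_mul_of_nonneg_right (hB x) (Real.exp_pos _).le
      exact h1.trans h2
    have hξ0 : h ξ ≤ 0 := ge_of_tendsto (tendsto_gaussWeight_atBot A B) hup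
    have hξpos : 0 ≤ h ξ := mul_nonneg (h0 ξ) (Real.exp_pos _).le
    have hzero : h ξ = 0 := le_antisymm hξ0 hξpos
    have hexp : Real.exp (-((ξ + A) ^ 2 / 4)) ≠ 0 := Real.exp_ne_zero _
    have : Ô ξ * Real.exp (-((ξ + A) ^ 2 / 4)) = 0 := hzero
    rcases mul_eq_zero.1 this with h1 | h1
    · exact h1
    · exact absurd h1 hexp

/-- **(OSC) HAS NO BACKWARD SELF-SIMILAR SOLUTIONS, FOR ANY `K`.**  Let `O(t,z) = Ô(z/√(−t))/√(−t)` and `S(t,z) = Ŝ(z/√(−t))/√(−t)` be a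
self-similar pair with `Ô ∈ C²`, `0 ≤ Ô ≤ B`, `Ŝ` differentiable, `|Ŝ| ≤ A`, and suppose the plane-oscillation law (OSC)
`∂ₜO + ½∂_z(S·O) − ∂_zzO ≤ 0` holds at every point of the slice `t = −1` (where `O(−1,·) = Ô`, `S(−1,·) = Ŝ`).  Then `Ô ≡ 0`, i.e.
`O ≡ 0`.  (Contrast: `…Endgame.eq_zero_of_dini_of_typeI` needs `K = sup(−t)|S_z|/2 < 1/2`; here `Ŝ′` is free.) -/
theorem selfSimilar_osc_eq_zero {Ô Ŝ : ℝ → ℝ} {A B : ℝ} (hÔ : ContDiff ℝ 2 Ô) (hŜ : Differentiable ℝ Ŝ)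
    (hA : ∀ ξ, |Ŝ ξ| ≤ A) (h0 : ∀ ξ, 0 ≤ Ô ξ) (hB : ∀ ξ, Ô ξ ≤ B)
    (hosc : ∀ z, deriv (fun t : ℝ => Ô (z * (Real.sqrt (-t))⁻¹) * (Real.sqrt (-t))⁻¹) (-1)
      + (1 / 2) * deriv (fun x => Ŝ x * Ô x) z - deriv (deriv Ô) z ≤ 0) :
    ∀ ξ, Ô ξ = 0 := by
  have hÔd : Differentiable ℝ Ô := hÔ.differentiable (by norm_num)
  refine profile_eq_zero_of_similarityODE hÔ hŜ hA h0 hB fun ξ => ?_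
  have h := hosc ξ
  rw [(hasDerivAt_selfSimilar_time (hÔd ξ)).deriv] at h
  linarith

end Summit.NavierStokesRegularity.NavierStokesRegularity.Theorems.PoloidalWindowDoorLrcModEntireTwistingTHPlaneOscillationSimilarity
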